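import Summits.Ventures.PercRepro2.CaseOnePocketConn

/-!
# The pocket reduction of the case-1 rung
(blind cell PercRepro2, p1 g27; S5 §2.1: the statement vertex moves out of any mark-free pocket)

With the marks `o, a₁, a₂, b` outside the pocket `(W, x, P)` and `a₃ ∈ W`, every case-1 quantity at
`a₃` is the same in `G` and in the contracted graph `pocketEnds ends P e₀ a₃ x` under the contracted
weights `pocketW` (the eight transfers `Dpd_pocket`, …, `iExprT_pocket`, on the pattern of
`CaseOneSeries`): the pocket IS a pendant edge of weight `pocketProb`. In the contracted graph `a₃` is a
leaf at `x`, so K8 and its Q-side (`zSplit*_of_leaf_at`) give the four forms at `a₃` from the four forms at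
`x`: **`closedAt_of_pocket`** — `ClosedAt x` in the contracted graph implies `ClosedAt a₃` in `G`. This is
the cut-vertex generalisation of the pendant step of `CaseOneMoves` (`MoveStep.leafMove`): the pocket may
be any subgraph hanging at `x` — a `K₄`, say — not only a tree or a series–parallel thickening. With
`a₃ ∉ W` the same transfers say that a mark-free pendant blob at `x` is invisible to the four forms
(`fourForms_pocket_iff`). Own code; standard axioms. -/

namespace Summit.Ventures.PercRepro2

namespace CaseOne

section PocketTransfer
variable {V : Type*} {E : Type*} [Fintype E] [DecidableEq E] {R : Type*} [CommRing R]
variable {ends : E → Sym2 V} {W : Set V} {x : V} {P : Finset E} {e₀ : E} {o a₁ a₂ a₃ b z : V}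

/-! The designated vertex `z` of the contraction (the one vertex of the pocket whose connections to the
outside are kept, as the leaf edge `e₀ = {x, z}`) may be any of the five special vertices; each of
`o, a₁, a₂, a₃, b` is assumed outside `W` or equal to `z` (`connEvent_pocket`). The case of record is
`z = a₃` with the marks outside (`closedAt_of_pocket` below). -/

/-- `D` is unchanged by the contraction of a pocket preserving `a₁, a₂, a₃`. -/
theorem Dpd_pocket (p : E → R) (h : IsPocket ends W x P) (he : e₀ ∈ P) (h1 : a₁ ∉ W ∨ a₁ = z)
    (h2 : a₂ ∉ W ∨ a₂ = z) (ha : a₃ ∉ W ∨ a₃ = z) :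
    Dpd p ends a₁ a₂ a₃ = Dpd (pocketW p ends P e₀ z x) (pocketEnds ends P e₀ z x) a₁ a₂ a₃ := by
  unfold Dpd
  rw [connEvent_pocket (a₃ := z) h he h1 ha, connEvent_pocket (a₃ := z) h he h2 ha,
    connEvent_pocket (a₃ := z) h he h1 h2]
  simp only [← Set.preimage_compl, ← Set.preimage_inter, prob_pocket p ends P e₀ z x]

/-- `D_o` is unchanged by the contraction of a pocket preserving `o, a₁, a₂, a₃`. -/
theorem Dpdo_pocket (p : E → R) (h : IsPocket ends W x P) (he : e₀ ∈ P) (ho : o ∉ W ∨ o = z)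
    (h1 : a₁ ∉ W ∨ a₁ = z) (h2 : a₂ ∉ W ∨ a₂ = z) (ha : a₃ ∉ W ∨ a₃ = z) :
    Dpdo p ends o a₁ a₂ a₃ =
      Dpdo (pocketW p ends P e₀ z x) (pocketEnds ends P e₀ z x) o a₁ a₂ a₃ := by
  unfold Dpdo
  rw [connEvent_pocket (a₃ := z) h he h1 ho, connEvent_pocket (a₃ := z) h he h2 ho,
    connEvent_pocket (a₃ := z) h he h1 ha, connEvent_pocket (a₃ := z) h he h2 ha,
    connEvent_pocket (a₃ := z) h he h1 h2]
  simp only [← Set.preimage_compl, ← Set.preimage_inter, ← Set.preimage_union,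
    prob_pocket p ends P e₀ z x]

/-- `P(Q, o ∈ U)` is unchanged by the contraction of a pocket preserving `o, a₁, a₂`. -/
theorem Dqo_pocket (p : E → R) (h : IsPocket ends W x P) (he : e₀ ∈ P) (ho : o ∉ W ∨ o = z)
    (h1 : a₁ ∉ W ∨ a₁ = z) (h2 : a₂ ∉ W ∨ a₂ = z) :
    Dqo p ends o a₁ a₂ = Dqo (pocketW p ends P e₀ z x) (pocketEnds ends P e₀ z x) o a₁ a₂ := by
  unfold Dqo
  rw [connEvent_pocket (a₃ := z) h he h1 ho, connEvent_pocket (a₃ := z) h he h2 ho,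
    connEvent_pocket (a₃ := z) h he h1 h2]
  simp only [← Set.preimage_compl, ← Set.preimage_inter, ← Set.preimage_union,
    prob_pocket p ends P e₀ z x]

/-- `P(Q)` is unchanged by the contraction of a pocket preserving `a₁, a₂`. -/
theorem probQ_pocket (p : E → R) (h : IsPocket ends W x P) (he : e₀ ∈ P) (h1 : a₁ ∉ W ∨ a₁ = z)
    (h2 : a₂ ∉ W ∨ a₂ = z) :
    prob p (connEvent ends a₁ a₂)ᶜ =
      prob (pocketW p ends P e₀ z x) (connEvent (pocketEnds ends P e₀ z x) a₁ a₂)ᶜ := by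
  rw [connEvent_pocket (a₃ := z) h he h1 h2, ← Set.preimage_compl, prob_pocket p ends P e₀ z x]

/-- **`iiExpr` is unchanged by the contraction of a pocket preserving the five special vertices.** -/
theorem iiExpr_pocket (p : E → R) (h : IsPocket ends W x P) (he : e₀ ∈ P) (ho : o ∉ W ∨ o = z)
    (h1 : a₁ ∉ W ∨ a₁ = z) (h2 : a₂ ∉ W ∨ a₂ = z) (ha : a₃ ∉ W ∨ a₃ = z) (hb : b ∉ W ∨ b = z) :
    iiExpr p ends o a₁ a₂ a₃ b =
      iiExpr (pocketW p ends P e₀ z x) (pocketEnds ends P e₀ z x) o a₁ a₂ a₃ b := by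
  rw [iiExpr_eq_probs, iiExpr_eq_probs, Dpd_pocket p h he h1 h2 ha, Dpdo_pocket p h he ho h1 h2 ha]
  rw [connEvent_pocket (a₃ := z) h he h2 hb, connEvent_pocket (a₃ := z) h he h1 ha,
    connEvent_pocket (a₃ := z) h he h2 ho, connEvent_pocket (a₃ := z) h he h1 h2]
  simp only [← Set.preimage_compl, ← Set.preimage_inter, prob_pocket p ends P e₀ z x]

/-- **`iExpr` is unchanged by the contraction of a pocket preserving the five special vertices.** -/
theorem iExpr_pocket (p : E → R) (h : IsPocket ends W x P) (he : e₀ ∈ P) (ho : o ∉ W ∨ o = z)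
    (h1 : a₁ ∉ W ∨ a₁ = z) (h2 : a₂ ∉ W ∨ a₂ = z) (ha : a₃ ∉ W ∨ a₃ = z) (hb : b ∉ W ∨ b = z) :
    iExpr p ends o a₁ a₂ a₃ b =
      iExpr (pocketW p ends P e₀ z x) (pocketEnds ends P e₀ z x) o a₁ a₂ a₃ b := by
  rw [iExpr_eq_iExprT, iExpr_eq_iExprT, iExprT_eq, iExprT_eq, Dpd_pocket p h he h1 h2 ha,
    Dpdo_pocket p h he ho h1 h2 ha]
  rw [connEvent_pocket (a₃ := z) h he h1 hb, connEvent_pocket (a₃ := z) h he h1 ha,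
    connEvent_pocket (a₃ := z) h he h2 ho, connEvent_pocket (a₃ := z) h he h1 h2]
  simp only [← Set.preimage_compl, ← Set.preimage_inter, prob_pocket p ends P e₀ z x]

/-- **`iiExprT` is unchanged by the contraction of a pocket preserving the five special vertices** (any
threshold pair). -/
theorem iiExprT_pocket (p : E → R) (h : IsPocket ends W x P) (he : e₀ ∈ P) (ho : o ∉ W ∨ o = z)
    (h1 : a₁ ∉ W ∨ a₁ = z) (h2 : a₂ ∉ W ∨ a₂ = z) (ha : a₃ ∉ W ∨ a₃ = z) (hb : b ∉ W ∨ b = z)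
    (c₀ c₁ : R) :
    iiExprT p ends o a₁ a₂ a₃ b c₀ c₁ =
      iiExprT (pocketW p ends P e₀ z x) (pocketEnds ends P e₀ z x) o a₁ a₂ a₃ b c₀ c₁ := by
  rw [iiExprT_eq, iiExprT_eq]
  rw [connEvent_pocket (a₃ := z) h he h2 hb, connEvent_pocket (a₃ := z) h he h1 ha,
    connEvent_pocket (a₃ := z) h he h2 ho, connEvent_pocket (a₃ := z) h he h1 h2]
  simp only [← Set.preimage_compl, ← Set.preimage_inter, prob_pocket p ends P e₀ z x]

/-- **`iExprT` is unchanged by the contraction of a pocket preserving the five special vertices** (any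
threshold pair). -/
theorem iExprT_pocket (p : E → R) (h : IsPocket ends W x P) (he : e₀ ∈ P) (ho : o ∉ W ∨ o = z)
    (h1 : a₁ ∉ W ∨ a₁ = z) (h2 : a₂ ∉ W ∨ a₂ = z) (ha : a₃ ∉ W ∨ a₃ = z) (hb : b ∉ W ∨ b = z)
    (c₀ c₁ : R) :
    iExprT p ends o a₁ a₂ a₃ b c₀ c₁ =
      iExprT (pocketW p ends P e₀ z x) (pocketEnds ends P e₀ z x) o a₁ a₂ a₃ b c₀ c₁ := by
  rw [iExprT_eq, iExprT_eq]
  rw [connEvent_pocket (a₃ := z) h he h1 hb, connEvent_pocket (a₃ := z) h he h1 ha,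
    connEvent_pocket (a₃ := z) h he h2 ho, connEvent_pocket (a₃ := z) h he h1 h2]
  simp only [← Set.preimage_compl, ← Set.preimage_inter, prob_pocket p ends P e₀ z x]

end PocketTransfer

section PocketProps
variable {V : Type*} {E : Type*} [Fintype E] [DecidableEq E] {R : Type*} [CommRing R]
  [LinearOrder R]
variable {ends : E → Sym2 V} {W : Set V} {x : V} {P : Finset E} {e₀ : E} {o a₁ a₂ a₃ b z : V}
  (p : E → R) (h : IsPocket ends W x P) (he : e₀ ∈ P) (ho : o ∉ W ∨ o = z) (h1 : a₁ ∉ W ∨ a₁ = z)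
  (h2 : a₂ ∉ W ∨ a₂ = z) (ha : a₃ ∉ W ∨ a₃ = z) (hb : b ∉ W ∨ b = z)

include h he ho h1 h2 ha hb

/-- `(ii)` at `a₃` is the same in `G` and in the contracted graph. -/
theorem zSplitII_pocket_iff :
    ZSplitII p ends o a₁ a₂ a₃ b ↔
      ZSplitII (pocketW p ends P e₀ z x) (pocketEnds ends P e₀ z x) o a₁ a₂ a₃ b := by
  unfold ZSplitII
  rw [iiExpr_pocket p h he ho h1 h2 ha hb]

/-- `(ii-Q)` at `a₃` is the same in `G` and in the contracted graph. -/
theorem zSplitIIQ_pocket_iff :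
    ZSplitIIQ p ends o a₁ a₂ a₃ b ↔
      ZSplitIIQ (pocketW p ends P e₀ z x) (pocketEnds ends P e₀ z x) o a₁ a₂ a₃ b := by
  unfold ZSplitIIQ
  rw [iiExprT_pocket p h he ho h1 h2 ha hb, Dqo_pocket p h he ho h1 h2, probQ_pocket p h he h1 h2]

/-- `(i)` at `a₃` is the same in `G` and in the contracted graph. -/
theorem zSplitI_pocket_iff :
    ZSplitI p ends o a₁ a₂ a₃ b ↔
      ZSplitI (pocketW p ends P e₀ z x) (pocketEnds ends P e₀ z x) o a₁ a₂ a₃ b := by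
  unfold ZSplitI
  rw [iExpr_pocket p h he ho h1 h2 ha hb]

/-- `(i-Q)` at `a₃` is the same in `G` and in the contracted graph. -/
theorem zSplitIQ_pocket_iff :
    ZSplitIQ p ends o a₁ a₂ a₃ b ↔
      ZSplitIQ (pocketW p ends P e₀ z x) (pocketEnds ends P e₀ z x) o a₁ a₂ a₃ b := by
  unfold ZSplitIQ
  rw [iExprT_pocket p h he ho h1 h2 ha hb, Dqo_pocket p h he ho h1 h2, probQ_pocket p h he h1 h2]

/-- **The four forms at `a₃` are the same in `G` and in the contracted graph** whenever each of the five
special vertices is outside the pocket or is its designated vertex `z`: for `z = a₃ ∈ W` the pocket is a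
pendant edge at `x`; for `a₃ ∉ W` a pocket containing at most one mark (`z`) is, for the four forms at
`a₃`, the pendant edge `{x, z}` of weight `pocketProb`; with no special vertex inside a mark-free pendant
blob at `x` is invisible. -/
theorem fourForms_pocket_iff :
    FourForms p ends o a₁ a₂ a₃ b ↔
      FourForms (pocketW p ends P e₀ z x) (pocketEnds ends P e₀ z x) o a₁ a₂ a₃ b := by
  unfold FourForms
  rw [zSplitII_pocket_iff p h he ho h1 h2 ha hb, zSplitIIQ_pocket_iff p h he ho h1 h2 ha hb,
    zSplitI_pocket_iff p h he ho h1 h2 ha hb, zSplitIQ_pocket_iff p h he ho h1 h2 ha hb]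

end PocketProps

section PocketTheorem
variable {V : Type*} {E : Type*} [Fintype E] [DecidableEq E] {R : Type*} [CommRing R]
  [LinearOrder R] [IsStrictOrderedRing R]
variable {ends : E → Sym2 V} {W : Set V} {x : V} {P : Finset E} {e₀ : E} {o a₁ a₂ a₃ b : V}

/-- **The pocket reduction**: if the statement vertex `a₃` lies in a pocket `(W, x, P)` avoiding the
marks, the four forms at `a₃` for one weight vector follow from the four forms at the cut vertex `x` in
the contracted graph under the contracted weights. -/
theorem fourForms_of_pocket (p : E → R) (hp : IsProbVec p) (h : IsPocket ends W x P) (he : e₀ ∈ P)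
    (ha : a₃ ∈ W) (ho : o ∉ W) (h1 : a₁ ∉ W) (h2 : a₂ ∉ W) (hb : b ∉ W)
    (hx : FourForms (pocketW p ends P e₀ a₃ x) (pocketEnds ends P e₀ a₃ x) o a₁ a₂ x b) :
    FourForms p ends o a₁ a₂ a₃ b := by
  have hp' : IsProbVec (pocketW p ends P e₀ a₃ x) := IsProbVec.pocketW hp ends P e₀ a₃ x
  have hl : IsLeafAt (pocketEnds ends P e₀ a₃ x) x a₃ e₀ := h.isLeafAt_pocketEnds e₀ ha
  have ho' : o ≠ a₃ := fun h' => ho (h' ▸ ha)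
  have h1' : a₁ ≠ a₃ := fun h' => h1 (h' ▸ ha)
  have h2' : a₂ ≠ a₃ := fun h' => h2 (h' ▸ ha)
  have hb' : b ≠ a₃ := fun h' => hb (h' ▸ ha)
  rw [fourForms_pocket_iff p h he (Or.inl ho) (Or.inl h1) (Or.inl h2) (Or.inr rfl) (Or.inl hb)]
  exact ⟨zSplitII_of_leaf_at _ hp' hl o a₁ a₂ b ho' h1' h2' hb' hx.1 hx.2.1,
    zSplitIIQ_of_leaf_at _ hp' hl o a₁ a₂ b ho' h1' h2' hb' hx.2.1,
    zSplitI_of_leaf_at _ hp' hl o a₁ a₂ b ho' h1' h2' hb' hx.2.2.1 hx.2.2.2,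
    zSplitIQ_of_leaf_at _ hp' hl o a₁ a₂ b ho' h1' h2' hb' hx.2.2.2⟩

/-- **The statement vertex moves out of a mark-free pocket**: `ClosedAt x` in the contracted graph gives
`ClosedAt a₃` in `G`. -/
theorem closedAt_of_pocket (h : IsPocket ends W x P) (he : e₀ ∈ P) (ha : a₃ ∈ W) (ho : o ∉ W)
    (h1 : a₁ ∉ W) (h2 : a₂ ∉ W) (hb : b ∉ W)
    (hc : ClosedAt R o a₁ a₂ b E (pocketEnds ends P e₀ a₃ x) x) : ClosedAt R o a₁ a₂ b E ends a₃ :=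
  fun p hp => fourForms_of_pocket p hp h he ha ho h1 h2 hb
    (hc (pocketW p ends P e₀ a₃ x) (IsProbVec.pocketW hp ends P e₀ a₃ x))

/-- **A pocket preserving the five special vertices is a pendant edge, for the closed property too**:
whenever each of `o, a₁, a₂, a₃, b` is outside the pocket or is its designated vertex `z`, `ClosedAt a₃`
in the contracted graph gives `ClosedAt a₃` in `G` — in particular a mark-free pendant blob at `x` is
invisible (`z` arbitrary), and a pocket containing one mark `z` is the pendant edge `{x, z}` of weight
`pocketProb`. (The converse fails as a statement about ALL weight vectors of the contracted graph: the
leaf weight `pocketProb` need not range over `[0, 1]`.) -/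
theorem closedAt_of_pocket' {z : V} (h : IsPocket ends W x P) (he : e₀ ∈ P) (ho : o ∉ W ∨ o = z)
    (h1 : a₁ ∉ W ∨ a₁ = z) (h2 : a₂ ∉ W ∨ a₂ = z) (ha : a₃ ∉ W ∨ a₃ = z) (hb : b ∉ W ∨ b = z)
    (hc : ClosedAt R o a₁ a₂ b E (pocketEnds ends P e₀ z x) a₃) : ClosedAt R o a₁ a₂ b E ends a₃ :=
  fun p hp => (fourForms_pocket_iff p h he ho h1 h2 ha hb).2
    (hc (pocketW p ends P e₀ z x) (IsProbVec.pocketW hp ends P e₀ z x))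

end PocketTheorem

end CaseOne

end Summit.Ventures.PercRepro2
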